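import Summits.ValiantsHypothesis.ValiantsHypothesis.Theorems.DivisionGapDefs

/-!
# Crux `DivisionGap.PerDivisionHard` (stmt-ValiantsHypothesis-5065), line `pair-descent-jss-endpoint` —
stub `stub_sparseRigid`, part Flow: circulations of the block arsenal occupy many rows

The block arsenal `G(b,k) ⊕ M₀` (`BlockV`, `blockAdj` of `Theorems/DivisionGapDefs.lean`) is
`K_{b,b}` with every core edge `(i, j)` subdivided into the path
row `i` — col `(i,j,0)` — row `(i,j,0)` — col `(i,j,1)` — … — row `(i,j,k-1)` — col `j`,
padded by a perfect matching.  A CIRCULATION is an integer function `F` on (row label, column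
label) pairs, supported on edges, with vanishing row sums and column sums (e.g. the difference of
two exponent vectors with equal margins).  The girth substitute used by `stub_sparseRigid`
(`k ≥ 1`): `flow_padding_eq_zero` — a circulation vanishes on padding rows (one edge each);
`flow_path` — along the path `(i, j)` the values alternate in sign with constant absolute value
`|pathVal F i j|` (internal rows and columns carry exactly two edges); `flow_card_rows` — **a
nonzero circulation occupies at least `4k + 2` rows** (a nonzero path value at `(i, j)` forces,
by the zero sums at core row `i`, core column `j` and a second core row `i'`, nonzero path values
at `(i, j')`, `(i', j)`, `(i', j'')`, `i ≠ i'`, `j ∉ {j', j''}`: `2` core rows and `4k` internal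
rows); `placedFlow_card_rows`, `placedFlow_row_notPadding`, `stub_sparseRigid_flow` — the same
transported to a placement `eR eC : BlockV b k m ≃ Fin n` (`placedBlock`).
-/

noncomputable section

-- `Summit.ValiantsHypothesis.ValiantsHypothesis.…` is the tree's mandated single-conjunct layout
-- (Sub = Summit), so the duplicated namespace component is intended.
set_option linter.dupNamespace false

namespace Summit.ValiantsHypothesis.ValiantsHypothesis.Theorems.DivisionGapPerDivisionHard

open MvPolynomial Literature.Computability.AlgebraicComplexity
open Summit.ValiantsHypothesis.ValiantsHypothesis.Theorems.ZeroOneTransfer.Negative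
open scoped NNReal

variable {b k m : ℕ}

/-! ### Sums with few nonzero terms -/

/-- A finite sum whose nonzero terms all sit at one index. [folklore] -/
theorem sum_eq_of_ne_zero_imp_eq {ι : Type*} [Fintype ι] (g : ι → ℤ) (a : ι)
    (h : ∀ x, g x ≠ 0 → x = a) : ∑ x, g x = g a :=
  Fintype.sum_eq_single a fun x hx => by by_contra h0; exact hx (h x h0)

/-- A finite sum whose nonzero terms all sit at two distinct indices. [folklore] -/
theorem sum_eq_of_ne_zero_imp_or {ι : Type*} [Fintype ι] [DecidableEq ι] (g : ι → ℤ) (a c : ι)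
    (hac : a ≠ c) (h : ∀ x, g x ≠ 0 → x = a ∨ x = c) : ∑ x, g x = g a + g c :=
  Fintype.sum_eq_add a c hac fun x hx => by
    by_contra h0
    rcases h x h0 with rfl | rfl <;> [exact hx.1 rfl; exact hx.2 rfl]

/-- A finite sum whose nonzero terms all sit in the range of an injection. [folklore] -/
theorem sum_eq_sum_of_ne_zero_imp_range {ι κ : Type*} [Fintype ι] [Fintype κ] [DecidableEq ι]
    (g : ι → ℤ) (φ : κ → ι) (hφ : Function.Injective φ)
    (h : ∀ x, g x ≠ 0 → ∃ y, x = φ y) : ∑ x, g x = ∑ y, g (φ y) := by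
  refine (Fintype.sum_of_injective φ hφ (fun y => g (φ y)) g (fun x hx => ?_) fun _ => rfl).symm
  by_contra h0
  exact hx (let ⟨y, hy⟩ := h x h0; ⟨y, hy.symm⟩)

/-- In a zero-sum family a nonzero member has a nonzero companion. [folklore] -/
theorem exists_ne_of_sum_eq_zero {ι : Type*} [Fintype ι] [DecidableEq ι] {g : ι → ℤ}
    (hs : ∑ x, g x = 0) {a : ι} (ha : g a ≠ 0) : ∃ c, c ≠ a ∧ g c ≠ 0 := by
  by_contra hno
  push Not at hno
  rw [Fintype.sum_eq_single a fun x hx => hno x hx] at hs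
  exact ha hs

/-! ### The neighbourhoods of the block arsenal (`k ≥ 1`) -/

/-- The internal label `(i, j, t)` (it names both a row and a column). [folklore] -/
abbrev iv (i j : Fin b) (t : Fin k) : BlockV b k m := Sum.inr (Sum.inl (i, j, t))

/-- The column following the internal row `(i, j, t)` on its path: `(i, j, t+1)`, or the core
column `j` after the last internal row. [folklore] -/
def nextCol (i j : Fin b) (t : Fin k) : BlockV b k m :=
  if h : (t : ℕ) + 1 < k then iv i j ⟨t + 1, h⟩ else Sum.inl j

/-- The row preceding the internal column `(i, j, t)` on its path: `(i, j, t-1)`, or the core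
row `i` before the first internal column. [folklore] -/
def prevRow (i j : Fin b) (t : Fin k) : BlockV b k m :=
  if h : (t : ℕ) = 0 then Sum.inl i else iv i j ⟨t - 1, by omega⟩

/-- Neighbours of a core row (`k ≥ 1`): the first internal columns `(i, j, 0)`. [folklore] -/
theorem adj_coreRow (hk : 0 < k) {i : Fin b} {ℓ : BlockV b k m}
    (h : blockAdj b k m (Sum.inl i) ℓ = true) : ∃ j, ℓ = iv i j ⟨0, hk⟩ := by
  rcases ℓ with j | ⟨i', j', t'⟩ | u
  · simp only [blockAdj, decide_eq_true_eq] at h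
    omega
  · simp only [blockAdj, decide_eq_true_eq] at h
    obtain ⟨rfl, ht⟩ := h
    exact ⟨j', by rw [iv, show t' = ⟨0, hk⟩ from Fin.ext ht]⟩
  · simp [blockAdj] at h

/-- Neighbours of an internal row `(i, j, t)`: the columns `(i, j, t)` and `nextCol i j t`.
[folklore] -/
theorem adj_internalRow {i j : Fin b} {t : Fin k} {ℓ : BlockV b k m}
    (h : blockAdj b k m (iv i j t) ℓ = true) : ℓ = iv i j t ∨ ℓ = nextCol i j t := by
  rcases ℓ with j' | ⟨i', j', t'⟩ | u
  · simp only [blockAdj, decide_eq_true_eq] at h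
    obtain ⟨rfl, ht⟩ := h
    right
    rw [nextCol, dif_neg (by omega)]
  · simp only [blockAdj, decide_eq_true_eq] at h
    obtain ⟨rfl, rfl, ht | ht⟩ := h
    · left
      rw [show t' = t from Fin.ext ht]
    · right
      rw [nextCol, dif_pos (by omega)]
      simp only [iv, Sum.inr.injEq, Sum.inl.injEq, Prod.mk.injEq, true_and]
      exact Fin.ext ht
  · simp [blockAdj] at h

/-- Neighbours of a padding row: its own padding column only. [folklore] -/
theorem adj_paddingRow {u : Fin m} {ℓ : BlockV b k m}
    (h : blockAdj b k m (Sum.inr (Sum.inr u)) ℓ = true) : ℓ = Sum.inr (Sum.inr u) := by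
  rcases ℓ with j' | ⟨i', j', t'⟩ | u'
  · simp [blockAdj] at h
  · simp [blockAdj] at h
  · simp only [blockAdj, decide_eq_true_eq] at h
    rw [h]

/-- Neighbours of a core column (`k ≥ 1`): the last internal rows `(i, j, k-1)`. [folklore] -/
theorem adj_coreCol (hk : 0 < k) {j : Fin b} {r : BlockV b k m}
    (h : blockAdj b k m r (Sum.inl j) = true) : ∃ i, r = iv i j ⟨k - 1, by omega⟩ := by
  rcases r with i | ⟨i', j', t'⟩ | u
  · simp only [blockAdj, decide_eq_true_eq] at h
    omega
  · simp only [blockAdj, decide_eq_true_eq] at h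
    obtain ⟨rfl, ht⟩ := h
    exact ⟨i', by rw [iv, show t' = ⟨k - 1, by omega⟩ from Fin.ext (by simp; omega)]⟩
  · simp [blockAdj] at h

/-- Neighbours of an internal column `(i, j, t)`: the rows `(i, j, t)` and `prevRow i j t`.
[folklore] -/
theorem adj_internalCol {i j : Fin b} {t : Fin k} {r : BlockV b k m}
    (h : blockAdj b k m r (iv i j t) = true) : r = iv i j t ∨ r = prevRow i j t := by
  rcases r with i' | ⟨i', j', t'⟩ | u
  · simp only [blockAdj, decide_eq_true_eq] at h
    obtain ⟨rfl, ht⟩ := h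
    right
    rw [prevRow, dif_pos ht]
  · simp only [blockAdj, decide_eq_true_eq] at h
    obtain ⟨rfl, rfl, ht | ht⟩ := h
    · left
      rw [show t' = t from Fin.ext ht.symm]
    · right
      rw [prevRow, dif_neg (by omega)]
      simp only [iv, Sum.inr.injEq, Sum.inl.injEq, Prod.mk.injEq, true_and]
      exact Fin.ext (by simp; omega)
  · simp [blockAdj] at h

/-- The row preceding the first internal column is the core row. [folklore] -/
theorem prevRow_zero (i j : Fin b) (hk : 0 < k) : (prevRow i j ⟨0, hk⟩ : BlockV b k m) = Sum.inl i :=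
  dif_pos rfl

/-- The row preceding a later internal column is the previous internal row. [folklore] -/
theorem prevRow_succ (i j : Fin b) (t : ℕ) (ht : t + 1 < k) :
    (prevRow i j ⟨t + 1, ht⟩ : BlockV b k m) = iv i j ⟨t, Nat.lt_of_succ_lt ht⟩ := by
  rw [prevRow, dif_neg (Nat.succ_ne_zero t)]
  simp

/-- The column following a non-final internal row is the next internal column. [folklore] -/
theorem nextCol_of_lt (i j : Fin b) (t : ℕ) (ht : t + 1 < k) :
    (nextCol i j ⟨t, Nat.lt_of_succ_lt ht⟩ : BlockV b k m) = iv i j ⟨t + 1, ht⟩ :=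
  dif_pos ht

/-- The column following the last internal row is the core column. [folklore] -/
theorem nextCol_last (i j : Fin b) (hk : 0 < k) :
    (nextCol i j ⟨k - 1, Nat.sub_lt hk Nat.one_pos⟩ : BlockV b k m) = Sum.inl j :=
  dif_neg (by simp; omega)

/-! ### Circulations in label coordinates -/

section Flow

variable (F : BlockV b k m → BlockV b k m → ℤ)

/-- The path value of `(i, j)`: the entry of `F` at the first cell (core row `i`, column
`(i, j, 0)`) of the path. [folklore] -/
def pathVal (hk : 0 < k) (i j : Fin b) : ℤ := F (Sum.inl i) (iv i j ⟨0, hk⟩)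

variable {F}
variable (hF : (∀ r ℓ, F r ℓ ≠ 0 → blockAdj b k m r ℓ = true) ∧
    (∀ r, ∑ ℓ, F r ℓ = 0) ∧ ∀ ℓ, ∑ r, F r ℓ = 0)
include hF

/-- A circulation vanishes on padding rows. [folklore] -/
theorem flow_padding_eq_zero (u : Fin m) (ℓ : BlockV b k m) : F (Sum.inr (Sum.inr u)) ℓ = 0 := by
  by_contra h0
  have hℓ := adj_paddingRow (hF.1 _ _ h0)
  subst hℓ
  have := hF.2.1 (Sum.inr (Sum.inr u))
  rw [sum_eq_of_ne_zero_imp_eq _ (Sum.inr (Sum.inr u)) fun x hx => adj_paddingRow (hF.1 _ _ hx)]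
    at this
  exact h0 this

/-- **Propagation along a path.**  The internal row `(i, j, t)` carries `-a` at its own column
`(i, j, t)` and `a` at the next column, `a = pathVal F hk i j`. [folklore] -/
theorem flow_path (hk : 0 < k) (i j : Fin b) :
    ∀ (t : ℕ) (ht : t < k), F (iv i j ⟨t, ht⟩) (iv i j ⟨t, ht⟩) = -pathVal F hk i j ∧
      F (iv i j ⟨t, ht⟩) (nextCol i j ⟨t, ht⟩) = pathVal F hk i j := by
  -- the two local conservation laws
  have hc : ∀ t : Fin k, F (prevRow i j t) (iv i j t) + F (iv i j t) (iv i j t) = 0 := by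
    intro t
    have hne : prevRow i j t ≠ (iv i j t : BlockV b k m) := by
      unfold prevRow
      split_ifs with h
      · simp [iv]
      · simp only [iv, ne_eq, Sum.inr.injEq, Sum.inl.injEq, Prod.mk.injEq, true_and]
        exact fun h' => by have := congrArg Fin.val h'; simp at this; omega
    have := hF.2.2 (iv i j t)
    rwa [sum_eq_of_ne_zero_imp_or _ (prevRow i j t) (iv i j t) hne fun x hx =>
      (adj_internalCol (hF.1 _ _ hx)).symm] at this
  have hr : ∀ t : Fin k, F (iv i j t) (iv i j t) + F (iv i j t) (nextCol i j t) = 0 := by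
    intro t
    have hne : (iv i j t : BlockV b k m) ≠ nextCol i j t := by
      unfold nextCol
      split_ifs with h
      · simp only [iv, ne_eq, Sum.inr.injEq, Sum.inl.injEq, Prod.mk.injEq, true_and]
        exact fun h' => by have := congrArg Fin.val h'; simp at this
      · simp [iv]
    have := hF.2.1 (iv i j t)
    rwa [sum_eq_of_ne_zero_imp_or _ (iv i j t) (nextCol i j t) hne fun x hx =>
      adj_internalRow (hF.1 _ _ hx)] at this
  intro t
  induction t with
  | zero =>
    intro ht
    have h1 := hc ⟨0, ht⟩
    rw [prevRow_zero] at h1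
    have h2 := hr ⟨0, ht⟩
    have h0 : pathVal F hk i j = F (Sum.inl i) (iv i j ⟨0, ht⟩) := rfl
    refine ⟨by omega, by omega⟩
  | succ t ih =>
    intro ht
    obtain ⟨-, ih2⟩ := ih (Nat.lt_of_succ_lt ht)
    rw [nextCol_of_lt i j t ht] at ih2
    have h1 := hc ⟨t + 1, ht⟩
    rw [prevRow_succ i j t ht] at h1
    have h2 := hr ⟨t + 1, ht⟩
    refine ⟨by omega, by omega⟩

/-- The last cell of the path `(i, j)` (row `(i, j, k-1)`, core column `j`) carries the path
value. [folklore] -/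
theorem flow_lastCell (hk : 0 < k) (i j : Fin b) :
    F (iv i j ⟨k - 1, Nat.sub_lt hk Nat.one_pos⟩) (Sum.inl j) = pathVal F hk i j := by
  have := (flow_path hF hk i j (k - 1) (Nat.sub_lt hk Nat.one_pos)).2
  rwa [nextCol_last i j hk] at this

/-- The path values out of a core row sum to zero. [folklore] -/
theorem sum_pathVal_row (hk : 0 < k) (i : Fin b) : ∑ j, pathVal F hk i j = 0 := by
  have := hF.2.1 (Sum.inl i)
  rwa [sum_eq_sum_of_ne_zero_imp_range _ (fun j => (iv i j ⟨0, hk⟩ : BlockV b k m))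
    (fun j j' h => by simpa [iv] using h) fun x hx => adj_coreRow hk (hF.1 _ _ hx)] at this

/-- The path values into a core column sum to zero. [folklore] -/
theorem sum_pathVal_col (hk : 0 < k) (j : Fin b) : ∑ i, pathVal F hk i j = 0 := by
  have := hF.2.2 (Sum.inl j)
  rw [sum_eq_sum_of_ne_zero_imp_range _ (fun i => (iv i j ⟨k - 1, by omega⟩ : BlockV b k m))
    (fun i i' h => by simpa [iv] using h) fun x hx => adj_coreCol hk (hF.1 _ _ hx)] at this
  simpa only [flow_lastCell hF hk] using this

/-- A nonzero entry of a circulation lies on a path with nonzero path value. [folklore] -/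
theorem exists_pathVal_ne_zero (hk : 0 < k) {r ℓ : BlockV b k m} (h : F r ℓ ≠ 0) :
    ∃ i j, pathVal F hk i j ≠ 0 := by
  have hadj := hF.1 _ _ h
  rcases r with i | ⟨i, j, t⟩ | u
  · obtain ⟨j, rfl⟩ := adj_coreRow hk hadj
    exact ⟨i, j, h⟩
  · have hp := flow_path hF hk i j t t.2
    rcases adj_internalRow (t := t) hadj with rfl | rfl
    · exact ⟨i, j, fun h0 => h (by rw [hp.1, h0, neg_zero])⟩
    · exact ⟨i, j, fun h0 => h (by rw [hp.2, h0])⟩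
  · exact absurd (flow_padding_eq_zero hF u ℓ) h

/-- The rows of a circulation touched by a nonzero path value: the core row and the `k`
internal rows of the path. [folklore] -/
theorem mem_rows_of_pathVal_ne_zero (hk : 0 < k) {i j : Fin b} (h : pathVal F hk i j ≠ 0) :
    Sum.inl i ∈ (Finset.univ.filter fun r : BlockV b k m => ∃ ℓ, F r ℓ ≠ 0) ∧
      ∀ t : Fin k, iv i j t ∈ (Finset.univ.filter fun r : BlockV b k m => ∃ ℓ, F r ℓ ≠ 0) := by
  refine ⟨Finset.mem_filter.mpr ⟨Finset.mem_univ _, _, h⟩, fun t => ?_⟩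
  refine Finset.mem_filter.mpr ⟨Finset.mem_univ _, iv i j t, ?_⟩
  rw [(flow_path hF hk i j t t.2).1]
  simpa using h

/-- **A nonzero circulation of the block arsenal occupies at least `4k + 2` rows.** [folklore] -/
theorem flow_card_rows (hk : 0 < k) (hne : ∃ r ℓ, F r ℓ ≠ 0) :
    4 * k + 2 ≤ (Finset.univ.filter fun r : BlockV b k m => ∃ ℓ, F r ℓ ≠ 0).card := by
  classical
  obtain ⟨r, ℓ, h⟩ := hne
  obtain ⟨i, j, hij⟩ := exists_pathVal_ne_zero hF hk h
  -- three more paths with nonzero values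
  obtain ⟨j', hj', hij'⟩ := exists_ne_of_sum_eq_zero (sum_pathVal_row hF hk i) hij
  obtain ⟨i', hi', hi'j⟩ :=
    exists_ne_of_sum_eq_zero (g := fun i => pathVal F hk i j) (sum_pathVal_col hF hk j) hij
  obtain ⟨j'', hj'', hi'j''⟩ := exists_ne_of_sum_eq_zero (sum_pathVal_row hF hk i') hi'j
  -- an injection from a type with `4k + 2` elements into the occupied rows
  let φ : Bool ⊕ (Bool × Bool × Fin k) → BlockV b k m
    | Sum.inl false => Sum.inl i
    | Sum.inl true => Sum.inl i'
    | Sum.inr (false, false, t) => iv i j t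
    | Sum.inr (false, true, t) => iv i j' t
    | Sum.inr (true, false, t) => iv i' j t
    | Sum.inr (true, true, t) => iv i' j'' t
  have hmem : ∀ x, φ x ∈ Finset.univ.filter fun r : BlockV b k m => ∃ ℓ, F r ℓ ≠ 0 := by
    rintro ((_ | _) | ⟨_ | _, _ | _, t⟩)
    · exact (mem_rows_of_pathVal_ne_zero hF hk hij).1
    · exact (mem_rows_of_pathVal_ne_zero hF hk hi'j).1
    · exact (mem_rows_of_pathVal_ne_zero hF hk hij).2 t
    · exact (mem_rows_of_pathVal_ne_zero hF hk hij').2 t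
    · exact (mem_rows_of_pathVal_ne_zero hF hk hi'j).2 t
    · exact (mem_rows_of_pathVal_ne_zero hF hk hi'j'').2 t
  have hinj : Function.Injective φ := by
    rintro ((_ | _) | ⟨_ | _, _ | _, t₁⟩) ((_ | _) | ⟨_ | _, _ | _, t₂⟩) h <;>
      simp only [φ, iv, Sum.inl.injEq, Sum.inr.injEq, Prod.mk.injEq, reduceCtorEq, hi', Ne.symm hi',
        hj', Ne.symm hj', hj'', Ne.symm hj'', false_and, and_false, true_and] at h <;>
      first
      | rfl
      | (subst h; rfl)
  calc 4 * k + 2 = (Finset.univ : Finset (Bool ⊕ (Bool × Bool × Fin k))).card := by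
        simp only [Finset.card_univ, Fintype.card_sum, Fintype.card_bool, Fintype.card_prod,
          Fintype.card_fin]
        ring
    _ ≤ (Finset.univ.filter fun r : BlockV b k m => ∃ ℓ, F r ℓ ≠ 0).card :=
        Finset.card_le_card_of_injOn φ (fun x _ => hmem x) (hinj.injOn.mono (Set.subset_univ _))

end Flow

/-! ### Transport to a placement -/

section Placed

variable {n : ℕ} (eR eC : BlockV b k m ≃ Fin n) {D : Fin n × Fin n → ℤ}

/-- Pulling an integer matrix back to label coordinates along a placement turns "supported on
the placed graph with vanishing row and column sums" into a circulation. [folklore] -/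
theorem labelFlow_of_placed (hG : ∀ e, D e ≠ 0 → e ∈ placedBlock eR eC)
    (hrow : ∀ r, ∑ c, D (r, c) = 0) (hcol : ∀ c, ∑ r, D (r, c) = 0) :
    (∀ r ℓ, (fun r ℓ => D (eR r, eC ℓ)) r ℓ ≠ 0 → blockAdj b k m r ℓ = true) ∧
      (∀ r, ∑ ℓ, (fun r ℓ => D (eR r, eC ℓ)) r ℓ = 0) ∧
        ∀ ℓ, ∑ r, (fun r ℓ => D (eR r, eC ℓ)) r ℓ = 0 := by
  refine ⟨fun r ℓ h => ?_, fun r => ?_, fun ℓ => ?_⟩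
  · have := hG _ h
    simpa [placedBlock] using this
  · rw [← hrow (eR r)]
    exact Equiv.sum_comp eC (fun c => D (eR r, c))
  · rw [← hcol (eC ℓ)]
    exact Equiv.sum_comp eR (fun r => D (r, eC ℓ))

/-- **Placed form, rows are corner rows.**  An integer matrix supported on the placed block
graph with vanishing row and column sums vanishes on every row labelled by a padding vertex.
[folklore] -/
theorem placedFlow_row_notPadding (hG : ∀ e, D e ≠ 0 → e ∈ placedBlock eR eC)
    (hrow : ∀ r, ∑ c, D (r, c) = 0) (hcol : ∀ c, ∑ r, D (r, c) = 0)
    {r c : Fin n} (h : D (r, c) ≠ 0) (u : Fin m) : eR.symm r ≠ Sum.inr (Sum.inr u) := by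
  intro hu
  have h0 : D (eR (Sum.inr (Sum.inr u)), eC (eC.symm c)) = 0 :=
    flow_padding_eq_zero (labelFlow_of_placed eR eC hG hrow hcol) u (eC.symm c)
  rw [← hu, Equiv.apply_symm_apply, Equiv.apply_symm_apply] at h0
  exact h h0

/-- **Placed form of the girth substitute.**  A nonzero integer matrix supported on the placed
block graph (`k ≥ 1`) with vanishing row and column sums has nonzero entries in at least
`4k + 2` rows. [folklore] -/
theorem placedFlow_card_rows (hk : 0 < k) (hG : ∀ e, D e ≠ 0 → e ∈ placedBlock eR eC)
    (hrow : ∀ r, ∑ c, D (r, c) = 0) (hcol : ∀ c, ∑ r, D (r, c) = 0) (hne : ∃ e, D e ≠ 0) :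
    4 * k + 2 ≤ (Finset.univ.filter fun r : Fin n => ∃ c, D (r, c) ≠ 0).card := by
  classical
  have hF := labelFlow_of_placed eR eC hG hrow hcol
  obtain ⟨⟨r₀, c₀⟩, h₀⟩ := hne
  have hne' : ∃ r ℓ, (fun r ℓ => D (eR r, eC ℓ)) r ℓ ≠ 0 :=
    ⟨eR.symm r₀, eC.symm c₀, by simpa using h₀⟩
  refine (flow_card_rows hF hk hne').trans (le_of_eq ?_)
  rw [← Finset.card_map eR.toEmbedding]
  congr 1
  ext r
  simp only [Finset.mem_map, Finset.mem_filter, Finset.mem_univ, true_and,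
    Equiv.coe_toEmbedding]
  constructor
  · rintro ⟨x, ⟨ℓ, hℓ⟩, rfl⟩
    exact ⟨eC ℓ, hℓ⟩
  · rintro ⟨c, hc⟩
    exact ⟨eR.symm r, ⟨eC.symm c, by simpa using hc⟩, by simp⟩

end Placed

/-- **`stub_sparseRigid`, part Flow (registered sub-goal): the girth substitute.**  A nonzero
integer matrix supported on a placed block graph `G(b,k) ⊕ M₀` (`k ≥ 1`) whose row sums and
column sums all vanish has nonzero entries in at least `4k + 2` distinct rows. [folklore] -/
theorem stub_sparseRigid_flow :
    ∀ (b k m n : ℕ) (eR eC : BlockV b k m ≃ Fin n) (D : Fin n × Fin n → ℤ), 0 < k →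
      (∀ e, D e ≠ 0 → e ∈ placedBlock eR eC) → (∀ r, ∑ c, D (r, c) = 0) →
      (∀ c, ∑ r, D (r, c) = 0) → (∃ e, D e ≠ 0) →
      4 * k + 2 ≤ (Finset.univ.filter fun r : Fin n => ∃ c, D (r, c) ≠ 0).card :=
  fun _ _ _ _ eR eC _ hk hG hrow hcol hne => placedFlow_card_rows eR eC hk hG hrow hcol hne

end Summit.ValiantsHypothesis.ValiantsHypothesis.Theorems.DivisionGapPerDivisionHard

end
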